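import Summits.CriticalPhenomena.PercolationContinuityZ3.Theorems.Transplant.AutChartOrbitsOneLampAutDefs
import HarnessLib

/-!
# Label-preserving actions on a one-lamp frame, II: the lamp sign depends on the POSITION only; the left rule; the square of a tree-trivial element
# is a pure lamp translation

builds on p205010 (kernel theorem, internal audit signed; external expert review pending) — nothing in this file uses p205010; pure group theory, no
percolation statement, nothing about any `@[conjecture]`.  Lane `prim-bschramm`, seat `prim-bschramm-p3` gen 36 (DESIGN OWNER; `P3-NILPOTENT.md` §29.3 (a)).
Helper file (`--supports stmt-CriticalPhenomena-4575 --as helper`).  Def-free.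

CONTENT (for a `OneLampFrame F` and a label-preserving action `A : F.LabelAction 𝒜`, «AutChartOrbitsOneLampAutDefs»):
* §1 `sgn_conj_mul` — THE COMMUTING SQUARE: moving a lamp at ANOTHER position does not change the sign of `α` at a vertex (the two ways round the square
  `γ ↦ y z γ` give `s^{a′−a} = w^{b′−b}` for two distinct positions, and FREENESS forces `a′ = a`); with the constancy along a line this gives
  `sgn_mul_of_mem_L` (`sgn α (m γ) = sgn α γ`, `m ∈ L`), `sgn_of_pos_eq` (the sign depends on the position `pos γ` only).
* §2 `smul_conj_zpow_mul` — THE LEFT RULE: `α·((h s h⁻¹)^n · δ) = ((T h) s (T h)⁻¹)^{sgn α h · n} · (α·δ)` with `T = treePart α`, for every vertex `δ`.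
* §3 `exists_sq_smul_eq_mul` — an acting element with TRIVIAL TREE PART squares to a PURE LAMP TRANSLATION: `β²·γ = m₂·γ` for one `m₂ ∈ L` and all `γ`
  (`β` acts on `L` as `m ↦ f₀·θ(m)` with `θ` the multiplicative involution `h s h⁻¹ ↦ (h s h⁻¹)^{sgn β h}`).
[cite: BenjaminiSchramm1996, Conj. 4; §2] [cite: BartholdiErschler2012, §2 (permutational wreath products)]
-/

namespace Summit.CriticalPhenomena.PercolationContinuityZ3.Theorems.Transplant

namespace OneLampFrame

variable {Γ : Type} [Group Γ]

/-- The closure of the positions is contained in `L`. [folklore] -/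
theorem closure_positions_le (F : OneLampFrame Γ) : Subgroup.closure {y : Γ | ∃ h ∈ F.H, y = h * F.s * h⁻¹} ≤ F.L := by
  rw [Subgroup.closure_le]
  rintro y ⟨h, -, rfl⟩
  exact F.conj_mem_L F.s_mem h

namespace LabelAction

variable {F : OneLampFrame Γ} {𝒜 : Type} [Group 𝒜] [MulAction 𝒜 Γ] (A : F.LabelAction 𝒜)
include A

/-! ### §1 The commuting square: the sign depends on the position only -/

/-- **The commuting square.**  For `g ∈ H` and any vertex `δ`: `sgn α (g s g⁻¹ · δ) = sgn α δ` — moving the lamp at position `g s g⁻¹` does not change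
the sign of `α` on the line through `δ` (if the position is that of `δ` this is constancy along the line; otherwise the two ways round the square
`δ ↦ (pos δ)(g s g⁻¹) δ` give `s^{a′−a} = w^{b′−b}` for the distinct positions `s ≠ w := k s k⁻¹`, and freeness forces `a′ = a`). [folklore] -/
theorem sgn_conj_mul (α : 𝒜) {g : Γ} (hg : g ∈ F.H) (δ : Γ) : A.sgn α (g * F.s * g⁻¹ * δ) = A.sgn α δ := by
  by_cases hpos : g * F.s * g⁻¹ = F.pos δ
  · -- same position: `g s g⁻¹ δ = δ s`
    rw [hpos, ← F.mul_s_eq, A.sgn_mul_s]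
  -- the data of the square
  set k : Γ := (F.tr δ)⁻¹ * g with hk
  have hkH : k ∈ F.H := F.H.mul_mem (F.H.inv_mem (F.tr_mem δ)) hg
  set a : ℤ := A.sgn α δ with ha
  set a' : ℤ := A.sgn α (g * F.s * g⁻¹ * δ) with ha'
  set b : ℤ := A.sgn α (δ * k) with hb
  set b' : ℤ := A.sgn α (δ * F.s * k) with hb'
  -- `z (y δ) = z (δ s)`: transport with the vertex `δ s` (its tree part is `tr δ`)
  have htr : F.tr (δ * F.s) = F.tr δ := F.tr_mul_of_mem_L δ F.s_mem
  have e1 : α • (g * F.s * g⁻¹ * (δ * F.s)) = α • δ * F.s ^ a * (k * F.s ^ b' * k⁻¹) := by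
    rw [A.smul_conj_mul α hg (δ * F.s), htr, A.smul_mul_s α δ]
  -- `y (z δ) = (z δ) s`
  have e2 : α • (g * F.s * g⁻¹ * δ * F.s) = α • δ * (k * F.s ^ b * k⁻¹) * F.s ^ a' := by
    rw [A.smul_mul_s α, A.smul_conj_mul α hg δ]
  -- the two products are the same vertex
  have e12 : g * F.s * g⁻¹ * (δ * F.s) = g * F.s * g⁻¹ * δ * F.s := by group
  rw [e12, e2] at e1
  have e3 : k * F.s ^ b * k⁻¹ * F.s ^ a' = F.s ^ a * (k * F.s ^ b' * k⁻¹) := by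
    have := e1; rw [mul_assoc (α • δ), mul_assoc (α • δ)] at this; exact mul_left_cancel this
  -- rearrange in the abelian group `L`: `s^{a'} s^{-a} = w^{-b} w^{b'}` with `w = k s k⁻¹`
  have hwL : ∀ n : ℤ, k * F.s ^ n * k⁻¹ ∈ F.L := fun n => F.conj_mem_L (F.L.zpow_mem F.s_mem n) k
  have e4 : F.s ^ (a' - a) = (k * F.s * k⁻¹) ^ (b' - b) := by
    have hc1 : k * F.s ^ b * k⁻¹ * F.s ^ a' = F.s ^ a' * (k * F.s ^ b * k⁻¹) := F.comm _ (hwL b) _ (F.L.zpow_mem F.s_mem a')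
    rw [hc1] at e3
    rw [conj_zpow, zpow_sub, zpow_sub]
    calc F.s ^ a' * (F.s ^ a)⁻¹ = (F.s ^ a)⁻¹ * (F.s ^ a' * (k * F.s ^ b * k⁻¹)) * (k * F.s ^ b * k⁻¹)⁻¹ := by group
      _ = (F.s ^ a)⁻¹ * (F.s ^ a * (k * F.s ^ b' * k⁻¹)) * (k * F.s ^ b * k⁻¹)⁻¹ := by rw [e3]
      _ = k * (F.s ^ b' * (F.s ^ b)⁻¹) * k⁻¹ := by group
  -- the positions `s = 1 s 1⁻¹` and `k s k⁻¹` are distinct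
  have hne : (1 : Γ) * F.s * 1⁻¹ ≠ k * F.s * k⁻¹ := by
    intro h
    apply hpos
    have : g * F.s * g⁻¹ = F.tr δ * (k * F.s * k⁻¹) * (F.tr δ)⁻¹ := by rw [hk]; group
    rw [this, ← h]; unfold pos; group
  have e5 : ((1 : Γ) * F.s * 1⁻¹) ^ (a' - a) = (k * F.s * k⁻¹) ^ (b' - b) := by simpa using e4
  have := (F.free 1 F.H.one_mem k hkH hne _ _ e5).1
  omega

/-- **The sign does not see the lamp configuration**: `sgn α (m · γ) = sgn α γ` for every `m ∈ L`. [folklore] -/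
theorem sgn_mul_of_mem_L (α : 𝒜) {m : Γ} (hm : m ∈ F.L) (γ : Γ) : A.sgn α (m * γ) = A.sgn α γ := by
  have key : ∀ y ∈ Subgroup.closure {y : Γ | ∃ h ∈ F.H, y = h * F.s * h⁻¹}, ∀ δ : Γ, A.sgn α (y * δ) = A.sgn α δ := by
    intro y hy
    refine Subgroup.closure_induction (p := fun y _ => ∀ δ : Γ, A.sgn α (y * δ) = A.sgn α δ) ?_ ?_ ?_ ?_ hy
    · rintro y ⟨h, hh, rfl⟩ δ; exact A.sgn_conj_mul α hh δ
    · intro δ; rw [one_mul]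
    · intro x y _ _ hx hy δ; rw [mul_assoc, hx, hy]
    · intro x _ hx δ
      have := hx (x⁻¹ * δ)
      rw [mul_inv_cancel_left] at this
      exact this.symm
  exact key m (F.gen m hm) γ

/-- The sign at `γ` is the sign at its tree part. [folklore] -/
theorem sgn_eq_sgn_tr (α : 𝒜) (γ : Γ) : A.sgn α γ = A.sgn α (F.tr γ) := by
  conv_lhs => rw [← F.lam_mul_tr γ]
  exact A.sgn_mul_of_mem_L α (F.lam_mem γ) _

/-- Right multiplication by an element of `H` commuting with `s` keeps the sign. [folklore] -/
theorem sgn_mul_of_comm (α : 𝒜) (γ : Γ) {p : Γ} (hp : p ∈ F.H) (hc : p * F.s = F.s * p) : A.sgn α (γ * p) = A.sgn α γ := by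
  refine A.sgn_eq_of_smul ?_
  have hc' : Commute p (F.s ^ A.sgn α γ) := (show Commute p F.s from hc).zpow_right _
  calc α • (γ * p * F.s) = α • (γ * F.s * p) := by rw [mul_assoc, hc, ← mul_assoc]
    _ = α • γ * F.s ^ A.sgn α γ * p := by rw [A.smul_mul_of_mem_H α _ hp, A.smul_mul_s]
    _ = α • γ * p * F.s ^ A.sgn α γ := by rw [mul_assoc, ← hc'.eq, ← mul_assoc]
    _ = α • (γ * p) * F.s ^ A.sgn α γ := by rw [A.smul_mul_of_mem_H α _ hp]

/-- **The sign depends on the position only**: `pos γ = pos γ′ ⟹ sgn α γ = sgn α γ′`. [folklore] -/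
theorem sgn_of_pos_eq (α : 𝒜) {γ γ' : Γ} (h : F.pos γ = F.pos γ') : A.sgn α γ = A.sgn α γ' := by
  rw [A.sgn_eq_sgn_tr α γ, A.sgn_eq_sgn_tr α γ']
  have hp : (F.tr γ)⁻¹ * F.tr γ' ∈ F.H := F.H.mul_mem (F.H.inv_mem (F.tr_mem γ)) (F.tr_mem γ')
  have hc : (F.tr γ)⁻¹ * F.tr γ' * F.s = F.s * ((F.tr γ)⁻¹ * F.tr γ') := by
    unfold pos at h
    calc (F.tr γ)⁻¹ * F.tr γ' * F.s = (F.tr γ)⁻¹ * (F.tr γ' * F.s * (F.tr γ')⁻¹) * F.tr γ' := by group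
      _ = (F.tr γ)⁻¹ * (F.tr γ * F.s * (F.tr γ)⁻¹) * F.tr γ' := by rw [h]
      _ = F.s * ((F.tr γ)⁻¹ * F.tr γ') := by group
  have e : F.tr γ' = F.tr γ * ((F.tr γ)⁻¹ * F.tr γ') := by group
  rw [e, A.sgn_mul_of_comm α _ hp hc]

/-- The sign at the transported vertex `δ · (tr δ)⁻¹ h` is the sign at `h`. [folklore] -/
theorem sgn_mul_tr_inv_mul (α : 𝒜) (δ h : Γ) : A.sgn α (δ * ((F.tr δ)⁻¹ * h)) = A.sgn α h := by
  have e0 := F.lam_mul_tr δ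
  have e : δ * ((F.tr δ)⁻¹ * h) = F.lam δ * h :=
    calc δ * ((F.tr δ)⁻¹ * h) = F.lam δ * F.tr δ * ((F.tr δ)⁻¹ * h) := by rw [e0]
      _ = F.lam δ * h := by group
  rw [e, A.sgn_mul_of_mem_L α (F.lam_mem δ)]

/-! ### §2 The left rule -/

/-- **THE LEFT RULE.**  For `h ∈ H`, any vertex `δ` and `n ∈ ℤ`: `α·((h s h⁻¹)^n · δ) = ((T h) s (T h)⁻¹)^{sgn α h · n} · (α·δ)` with `T = treePart α` —
left multiplication by a power of the lamp at position `h s h⁻¹` is carried to left multiplication by the (signed) power of the lamp at the conjugated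
position. [folklore] -/
theorem smul_conj_zpow_mul (α : 𝒜) {h : Γ} (hh : h ∈ F.H) (δ : Γ) (n : ℤ) :
    α • ((h * F.s * h⁻¹) ^ n * δ) = (A.treePart α * h * F.s * (A.treePart α * h)⁻¹) ^ (A.sgn α h * n) * (α • δ) := by
  set k : Γ := (F.tr δ)⁻¹ * h with hk
  have hkH : k ∈ F.H := F.H.mul_mem (F.H.inv_mem (F.tr_mem δ)) hh
  -- transport to the right: `(h s h⁻¹)^n δ = ((δ k) s^n) k⁻¹`
  have e1 : (h * F.s * h⁻¹) ^ n * δ = δ * k * F.s ^ n * k⁻¹ := by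
    rw [F.left_mul_of_mem_L (F.L.zpow_mem (F.conj_mem_L F.s_mem h) n) δ, conj_zpow, hk]; group
  rw [e1, A.smul_mul_of_mem_H α _ (F.H.inv_mem hkH), A.smul_mul_s_zpow, A.smul_mul_of_mem_H α _ hkH, hk,
    A.sgn_mul_tr_inv_mul α δ h]
  -- back to the left of `α·δ`
  have hmL : (F.tr δ)⁻¹ * h * F.s ^ (A.sgn α h * n) * ((F.tr δ)⁻¹ * h)⁻¹ ∈ F.L := F.conj_mem_L (F.L.zpow_mem F.s_mem _) _
  rw [show α • δ * ((F.tr δ)⁻¹ * h) * F.s ^ (A.sgn α h * n) * ((F.tr δ)⁻¹ * h)⁻¹ =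
      α • δ * ((F.tr δ)⁻¹ * h * F.s ^ (A.sgn α h * n) * ((F.tr δ)⁻¹ * h)⁻¹) by group,
    F.mul_of_mem_L (α • δ) hmL, A.tr_smul, conj_zpow]
  group

/-- The left rule for an element with TRIVIAL TREE PART: `β·((h s h⁻¹)^n · δ) = (h s h⁻¹)^{sgn β h · n} · (β·δ)`. [folklore] -/
theorem smul_conj_zpow_mul_of_treePart {β : 𝒜} (hβ : A.treePart β = 1) {h : Γ} (hh : h ∈ F.H) (δ : Γ) (n : ℤ) :
    β • ((h * F.s * h⁻¹) ^ n * δ) = (h * F.s * h⁻¹) ^ (A.sgn β h * n) * (β • δ) := by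
  rw [A.smul_conj_zpow_mul β hh δ n, hβ, one_mul]

/-! ### §3 An element with trivial tree part squares to a pure lamp translation -/

/-- An element with trivial tree part maps lamps to lamps. [folklore] -/
theorem smul_mem_L_of_treePart {β : 𝒜} (hβ : A.treePart β = 1) {m : Γ} (hm : m ∈ F.L) : β • m ∈ F.L := by
  rw [A.smul_of_mem_L β hm, hβ, mul_one]; exact F.lam_mem _

/-- **An element with TRIVIAL TREE PART squares to a PURE LAMP TRANSLATION**: `(β·β)·γ = m₂·γ` for one `m₂ ∈ L` and every `γ`.  (On `L`, `β` acts as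
`m ↦ f₀·θ(m)` with `f₀ = β·1` and `θ` multiplicative, `θ(h s h⁻¹) = (h s h⁻¹)^{sgn β h}`, hence `θ ∘ θ = id` and `β²·m = f₀ θ(f₀) · m`.) [folklore] -/
theorem exists_sq_smul_eq_mul {β : 𝒜} (hβ : A.treePart β = 1) : ∃ m₂ ∈ F.L, ∀ γ : Γ, (β * β) • γ = m₂ * γ := by
  set f₀ : Γ := β • (1 : Γ) with hf₀
  have hf₀L : f₀ ∈ F.L := A.smul_mem_L_of_treePart hβ F.L.one_mem
  obtain ⟨θ, hθ⟩ : ∃ θ : Γ → Γ, ∀ m, θ m = f₀⁻¹ * β • m := ⟨fun m => f₀⁻¹ * β • m, fun _ => rfl⟩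
  have hθL : ∀ m ∈ F.L, θ m ∈ F.L := fun m hm => by
    rw [hθ]; exact F.L.mul_mem (F.L.inv_mem hf₀L) (A.smul_mem_L_of_treePart hβ hm)
  have hθ1 : θ 1 = 1 := by rw [hθ, ← hf₀, inv_mul_cancel]
  -- (K1) `θ ((h s h⁻¹)^n m) = (h s h⁻¹)^{ε n} θ m`
  have K1 : ∀ {h : Γ}, h ∈ F.H → ∀ (n : ℤ), ∀ m ∈ F.L,
      θ ((h * F.s * h⁻¹) ^ n * m) = (h * F.s * h⁻¹) ^ (A.sgn β h * n) * θ m := by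
    intro h hh n m hm
    rw [hθ, hθ, A.smul_conj_zpow_mul_of_treePart hβ hh m n]
    have hc := F.comm _ (F.L.inv_mem hf₀L) _ (F.L.zpow_mem (F.conj_mem_L F.s_mem h) (A.sgn β h * n))
    rw [← mul_assoc, hc, mul_assoc]
  -- (K3) multiplicativity on `L`
  have K3 : ∀ m₁ ∈ F.L, ∀ m₂ ∈ F.L, θ (m₁ * m₂) = θ m₁ * θ m₂ := by
    intro m₁ hm₁
    refine Subgroup.closure_induction (p := fun y _ => ∀ m₂ ∈ F.L, θ (y * m₂) = θ y * θ m₂) ?_ ?_ ?_ ?_ (F.gen m₁ hm₁)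
    · rintro y ⟨h, hh, rfl⟩ m₂ hm₂
      have e1 := K1 hh 1 m₂ hm₂
      have e2 := K1 hh 1 1 F.L.one_mem
      rw [zpow_one, mul_one] at e1 e2
      rw [mul_one, hθ1, mul_one] at e2
      rw [e1, e2]
    · intro m₂ _; rw [one_mul, hθ1, one_mul]
    · intro x y _ _ hx hy m₂ hm₂
      have hyL : y ∈ F.L := F.closure_positions_le (by assumption)
      rw [mul_assoc, hx _ (F.L.mul_mem hyL hm₂), hy _ hm₂, hx _ hyL]
      exact (mul_assoc (θ x) (θ y) (θ m₂)).symm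
    · intro x hx' hx m₂ hm₂
      have hxL : x ∈ F.L := F.closure_positions_le hx'
      have e1 := hx _ (F.L.mul_mem (F.L.inv_mem hxL) hm₂)
      rw [mul_inv_cancel_left] at e1
      have e2 := hx _ (F.L.inv_mem hxL)
      rw [mul_inv_cancel, hθ1] at e2
      -- `θ x⁻¹ = (θ x)⁻¹` and `θ (x⁻¹ m₂) = (θ x)⁻¹ θ m₂`
      have e3 : θ x⁻¹ = (θ x)⁻¹ := (eq_inv_of_mul_eq_one_right e2.symm)
      rw [e3]
      rw [e1]; group
  -- `θ` commutes with inversion on `L`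
  have Kinv : ∀ m ∈ F.L, θ m⁻¹ = (θ m)⁻¹ := by
    intro m hm
    have e := K3 m hm m⁻¹ (F.L.inv_mem hm)
    rw [mul_inv_cancel, hθ1] at e
    exact eq_inv_of_mul_eq_one_right e.symm
  -- (K4) `θ` is an involution on `L`
  have K4 : ∀ m ∈ F.L, θ (θ m) = m := by
    intro m hm
    refine Subgroup.closure_induction (p := fun y _ => θ (θ y) = y) ?_ ?_ ?_ ?_ (F.gen m hm)
    · rintro y ⟨h, hh, rfl⟩
      have e1 := K1 hh 1 1 F.L.one_mem
      rw [zpow_one, mul_one, mul_one, hθ1, mul_one] at e1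
      have e2 := K1 hh (A.sgn β h) 1 F.L.one_mem
      rw [mul_one, hθ1, mul_one, A.sgn_mul_self, zpow_one] at e2
      rw [e1, e2]
    · rw [hθ1, hθ1]
    · intro x y hx' hy' hx hy
      have hxL : x ∈ F.L := F.closure_positions_le hx'
      have hyL : y ∈ F.L := F.closure_positions_le hy'
      rw [K3 x hxL y hyL, K3 _ (hθL x hxL) _ (hθL y hyL), hx, hy]
    · intro x hx' hx
      have hxL : x ∈ F.L := F.closure_positions_le hx'
      rw [Kinv x hxL, Kinv _ (hθL x hxL), hx]
  -- `β·m = f₀ θ m` and the square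
  have hβm : ∀ m : Γ, β • m = f₀ * θ m := fun m => by rw [hθ, mul_inv_cancel_left]
  refine ⟨f₀ * θ f₀, F.L.mul_mem hf₀L (hθL _ hf₀L), fun γ => ?_⟩
  have eγ := F.lam_mul_tr γ
  calc (β * β) • γ = β • (β • (F.lam γ * F.tr γ)) := by rw [mul_smul, eγ]
    _ = β • (f₀ * θ (F.lam γ) * F.tr γ) := by rw [A.smul_mul_of_mem_H β _ (F.tr_mem γ), hβm (F.lam γ)]
    _ = f₀ * θ (f₀ * θ (F.lam γ)) * F.tr γ := by
          rw [A.smul_mul_of_mem_H β _ (F.tr_mem γ), hβm (f₀ * θ (F.lam γ))]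
    _ = f₀ * (θ f₀ * F.lam γ) * F.tr γ := by rw [K3 _ hf₀L _ (hθL _ (F.lam_mem γ)), K4 _ (F.lam_mem γ)]
    _ = f₀ * θ f₀ * (F.lam γ * F.tr γ) := by group
    _ = f₀ * θ f₀ * γ := by rw [eγ]

end LabelAction

end OneLampFrame

end Summit.CriticalPhenomena.PercolationContinuityZ3.Theorems.Transplant
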